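import Mathlib
import Summits.MatrixMultiplication.MatrixMultiplication.Theorems.SubgroupIdentityDesigns.Negative.BorelGhost

/-!
# Level-one identity designs come in `H₁ × H₃`-families (negative-side structure lemma for the crux
`SubgroupIdentityDesigns`, stmt-MatrixMultiplication-14079; cell B2b-5, gen 7 — report
`run/shared/lean/b2b/levelgraded-cu/ORACLE-g7.md` §G7-1, filter FR)

The span `F₁` of the level-`≤ 1` modes `s ↦ ψ(tr(M s))`, `rk M ≤ 1`, is invariant under two-sided
translation: `f_c(A' s G') = f_{c'}(s)` with `c'(M) = c(G M A)` whenever `A A' = 1 = G' G`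
(`fourierMat_translate`), and `rk(G M A) = rk M` for invertible `A, G`.  Consequently, if `(H₁,H₂,H₃)` carries
a level-one identity design `f` (`f(1) = 1`, `f = 0` on `H₁H₂H₃ ∖ {1}`), then for every `a₀ ∈ H₁`, `g₀ ∈ H₃`
the translate `s ↦ f(a₀⁻¹ s g₀⁻¹)` is a level-one function equal to `δ_{a₀g₀}` on `S = H₁H₂H₃`
(`levelOne_design_translate`).  So a design forces ALL `|H₁|·|H₃|` deltas `δ_x`, `x ∈ H₁H₃`, into `F₁|_S`;
with `dim F₁|_{GL₂(𝔽_p)} = 1 + p² + (p-2)(p+1)²` this is the RANK OBSTRUCTION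
`|H₁||H₃| + dim F₁|_{S ∖ H₁H₃} ≤ dim F₁|_{GL₂}` used (with a certified GF(2)-rank lower bound) as the exact
filter FR of the gen-7 census; only the translation half is formalised here.
Sorry-free.  VALUE = structure lemma behind a certificate format, NOT summit progress.
-/

set_option linter.dupNamespace false

noncomputable section

open scoped BigOperators Classical
open Matrix
open Summit.MatrixMultiplication.MatrixMultiplication.Theorems.LieRankDesigns.Negative (GLm Mat)

namespace Summit.MatrixMultiplication.MatrixMultiplication.Theorems.SubgroupIdentityDesigns.Negative

variable {p : ℕ} [Fact p.Prime]

section DesignTranslate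

/-- Two-sided translation of a mode table: `f_{c ∘ (G · A)}(s) = f_c(A' s G')` when `A A' = 1 = G' G`. -/
theorem fourierMat_translate (c : CMat p 2 → ℂ) (A A' G G' : CMat p 2) (hA : A * A' = 1)
    (hG : G' * G = 1) (s : CMat p 2) :
    fourierMat (fun M => c (G * M * A)) s = fourierMat c (A' * s * G') := by
  have hA' : A' * A = 1 := mul_eq_one_comm.mp hA
  have hG'' : G * G' = 1 := mul_eq_one_comm.mp hG
  let e : CMat p 2 ≃ CMat p 2 :=
    { toFun := fun M => G * M * A
      invFun := fun N => G' * N * A'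
      left_inv := fun M => by
        show G' * (G * M * A) * A' = M
        calc G' * (G * M * A) * A' = (G' * G) * M * (A * A') := by noncomm_ring
          _ = M := by rw [hG, hA, one_mul, mul_one]
      right_inv := fun N => by
        show G * (G' * N * A') * A = N
        calc G * (G' * N * A') * A = (G * G') * N * (A' * A) := by noncomm_ring
          _ = N := by rw [hG'', hA', one_mul, mul_one] }
  unfold fourierMat
  rw [← e.sum_comp (fun N => c N * ZMod.stdAddChar (Matrix.trace (N * (A' * s * G'))))]
  refine Finset.sum_congr rfl fun M _ => ?_
  show c (G * M * A) * _ = c (G * M * A) * ZMod.stdAddChar (Matrix.trace (G * M * A * (A' * s * G')))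
  congr 2
  calc Matrix.trace (M * s) = Matrix.trace (M * s * (G' * G)) := by rw [hG, mul_one]
    _ = Matrix.trace (G * (M * s * G')) := by rw [← mul_assoc, Matrix.trace_mul_comm]
    _ = Matrix.trace (G * M * A * (A' * s * G')) := by
        congr 1
        calc G * (M * s * G') = G * M * (A * A') * s * G' := by rw [hA]; noncomm_ring
          _ = G * M * A * (A' * s * G') := by noncomm_ring

/-- Rank is invariant under two-sided multiplication by invertible matrices. [folklore] -/
theorem rank_conj_eq (M A G : CMat p 2) (hA : IsUnit A.det) (hG : IsUnit G.det) :
    (G * M * A).rank = M.rank := by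
  rw [Matrix.rank_mul_eq_left_of_isUnit_det A (G * M) hA, Matrix.rank_mul_eq_right_of_isUnit_det G M hG]

/-- **LEVEL-ONE IDENTITY DESIGNS COME IN `H₁ × H₃`-FAMILIES.**  If `c` (supported on rank `≤ 1`) is an
identity design for `(H₁, H₂, H₃)` — `f_c(1) = 1` and `f_c(a b g) = 0` whenever `a b g ≠ 1` — then for all
`a₀ ∈ H₁`, `g₀ ∈ H₃` the table `c'(M) = c(g₀ M a₀)` is again supported on rank `≤ 1`, and `f_{c'}` is the
design AT `a₀ g₀`: `f_{c'}(a₀ g₀) = 1` and `f_{c'}(a b g) = 0` whenever `a b g ≠ a₀ g₀`.  (Hence a design puts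
every `δ_x`, `x ∈ H₁H₃`, into `F₁|_S` — the rank obstruction of the gen-7 census.) -/
theorem levelOne_design_translate {H₁ H₂ H₃ : Subgroup (GLm p 2)} (c : Mat p 2 → ℂ)
    (hc : ∀ M : Mat p 2, 1 < M.rank → c M = 0) (h1 : fourierMat c 1 = 1)
    (h0 : ∀ a ∈ H₁, ∀ b ∈ H₂, ∀ g ∈ H₃, a * b * g ≠ 1 → fourierMat c ((a * b * g : GLm p 2) : Mat p 2) = 0)
    {a₀ g₀ : GLm p 2} (ha₀ : a₀ ∈ H₁) (hg₀ : g₀ ∈ H₃) :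
    let c' : Mat p 2 → ℂ := fun M => c ((g₀ : Mat p 2) * M * (a₀ : Mat p 2))
    (∀ M : Mat p 2, 1 < M.rank → c' M = 0) ∧ fourierMat c' ((a₀ * g₀ : GLm p 2) : Mat p 2) = 1 ∧
      ∀ a ∈ H₁, ∀ b ∈ H₂, ∀ g ∈ H₃, a * b * g ≠ a₀ * g₀ →
        fourierMat c' ((a * b * g : GLm p 2) : Mat p 2) = 0 := by
  intro c'
  have hA : (a₀ : Mat p 2) * ((a₀⁻¹ : GLm p 2) : Mat p 2) = 1 := by
    rw [← Units.val_mul, mul_inv_cancel, Units.val_one]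
  have hG : ((g₀⁻¹ : GLm p 2) : Mat p 2) * (g₀ : Mat p 2) = 1 := by
    rw [← Units.val_mul, inv_mul_cancel, Units.val_one]
  have htr : ∀ s : Mat p 2, fourierMat c' s =
      fourierMat c (((a₀⁻¹ : GLm p 2) : Mat p 2) * s * ((g₀⁻¹ : GLm p 2) : Mat p 2)) :=
    fun s => fourierMat_translate c _ _ _ _ hA hG s
  refine ⟨?_, ?_, ?_⟩
  · intro M hM
    apply hc
    rwa [rank_conj_eq M _ _ (Matrix.isUnit_det_of_right_inverse hA) (Matrix.isUnit_det_of_left_inverse hG)]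
  · rw [htr, Units.val_mul]
    have : ((a₀⁻¹ : GLm p 2) : Mat p 2) * ((a₀ : Mat p 2) * (g₀ : Mat p 2)) * ((g₀⁻¹ : GLm p 2) : Mat p 2)
        = 1 := by
      rw [← Units.val_mul, ← Units.val_mul, ← Units.val_mul]
      simp
    rw [this, h1]
  · intro a ha b hb g hg hne
    rw [htr]
    have hmem₁ : a₀⁻¹ * a ∈ H₁ := H₁.mul_mem (H₁.inv_mem ha₀) ha
    have hmem₃ : g * g₀⁻¹ ∈ H₃ := H₃.mul_mem hg (H₃.inv_mem hg₀)
    have hne' : (a₀⁻¹ * a) * b * (g * g₀⁻¹) ≠ 1 := by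
      intro h
      apply hne
      have : a * b * g = a₀ * ((a₀⁻¹ * a) * b * (g * g₀⁻¹)) * g₀ := by group
      rw [this, h, mul_one]
    have key := h0 _ hmem₁ b hb _ hmem₃ hne'
    have hval : ((a₀⁻¹ * a * b * (g * g₀⁻¹) : GLm p 2) : Mat p 2)
        = ((a₀⁻¹ : GLm p 2) : Mat p 2) * ((a * b * g : GLm p 2) : Mat p 2) * ((g₀⁻¹ : GLm p 2) : Mat p 2) := by
      simp only [Units.val_mul]
      noncomm_ring
    rw [hval] at key
    exact key

end DesignTranslate

end Summit.MatrixMultiplication.MatrixMultiplication.Theorems.SubgroupIdentityDesigns.Negative
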